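import Mathlib.RingTheory.IntegralClosure.IntegrallyClosed
import Mathlib.RingTheory.Localization.FractionRing
import Mathlib.RingTheory.Localization.Integral
import Mathlib.RingTheory.Finiteness.Basic
import Mathlib.Algebra.CharP.Lemmas
import HarnessLib

/-!
# `PAlteration.Assembly` (stmt-ResolutionOfSingularities-0553): the Frobenius factor of a finite radicial extension of a normal domain

Route `ResolutionOfSingularities/pAlteration`, item `Assembly` (stmt-0553); helper file
(`--supports`). Pure commutative algebra behind the Frobenius-pullback step:

**Theorem** (`exists_frobeniusFactor`). Let `φ : A → C` be an injective finite homomorphism of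
domains of characteristic `p` with `A` integrally closed, and suppose every `c ∈ C` is
*radicial over the fractions of `A`*: `φ(s) · c^{p^n} = φ(a)` for some `n` and `a, s ∈ A`,
`s ≠ 0`. Then there are `N` and a ring homomorphism `σ : C → A` with `φ ∘ σ = Frob^N` and
`σ ∘ φ = Frob^N`.

Proof: `c^{p^n} = φ(a)/φ(s)` is integral over `A` (finiteness) and lies in `Frac A`, hence in
`A` (normality); a uniform exponent exists because `C` is a finitely generated `A`-module and
`x ↦ x^{p^N}` is additive; `σ(c)` is the unique preimage of `c^{p^N}`.
-/

-- single-problem summit: the doubled namespace component `ResolutionOfSingularities` is forced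
set_option linter.dupNamespace false

noncomputable section

namespace Summit.ResolutionOfSingularities.ResolutionOfSingularities.Theorems

open Polynomial

/-- Normality step: if `φ : A → C` is an injective integral homomorphism of domains with `A`
integrally closed, and `φ(s) · y = φ(a)` with `s ≠ 0`, then `y ∈ φ(A)` (the fraction `a/s` is
integral over `A`, hence lies in `A`). [folklore] -/
theorem exists_eq_of_mul_eq_of_isIntegral {A C : Type*} [CommRing A] [IsDomain A] [CommRing C]
    [IsDomain C] [IsIntegrallyClosed A] (φ : A →+* C) (hφ : Function.Injective φ)
    (y : C) (hy : φ.IsIntegralElem y) {a s : A} (hs : s ≠ 0) (h : φ s * y = φ a) :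
    ∃ b : A, φ b = y := by
  letI : Algebra A C := φ.toAlgebra
  let K := FractionRing A
  let L := FractionRing C
  have halg : algebraMap A L = (algebraMap C L).comp φ := IsScalarTower.algebraMap_eq A C L
  have hinjAL : Function.Injective (algebraMap A L) := by
    rw [halg]; exact (IsFractionRing.injective C L).comp hφ
  let j : K →ₐ[A] L := IsFractionRing.liftAlgHom (K := K) (g := Algebra.ofId A L) hinjAL
  have hj : Function.Injective j := j.toRingHom.injective
  -- the fraction `a / s ∈ K` maps to `y ∈ L`
  have hsK : algebraMap A K s ≠ 0 := fun h0 =>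
    hs (IsFractionRing.injective A K (by rw [h0, map_zero]))
  set κ : K := algebraMap A K a / algebraMap A K s with hκ
  have hsL : algebraMap A L s ≠ 0 := fun h0 => hs (hinjAL (by rw [h0, map_zero]))
  have hyL : algebraMap C L y = algebraMap A L a / algebraMap A L s := by
    rw [eq_div_iff hsL, mul_comm, halg]
    have := congrArg (algebraMap C L) h
    simpa only [map_mul, RingHom.comp_apply] using this
  have hjκ : j κ = algebraMap C L y := by
    rw [hyL, hκ, map_div₀, AlgHom.commutes, AlgHom.commutes]
  -- integrality transfers to `κ`, and `A` is integrally closed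
  have hyint : IsIntegral A y := hy
  have hκint : IsIntegral A κ := by
    rw [← isIntegral_algHom_iff j hj, hjκ]
    exact hyint.algebraMap
  obtain ⟨b, hb⟩ := IsIntegrallyClosed.isIntegral_iff.mp hκint
  refine ⟨b, ?_⟩
  -- `b / 1 = a / s` in `K` gives `b * s = a` in `A`, hence `φ b * φ s = φ s * y`
  have hbs : b * s = a := by
    apply IsFractionRing.injective A K
    rw [map_mul, hb, hκ, div_mul_cancel₀ _ hsK]
  have : φ s * φ b = φ s * y := by rw [← map_mul, mul_comm, hbs, h]
  exact mul_left_cancel₀ (fun h0 => hs (hφ (by rw [h0, map_zero]))) this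

/-- **The Frobenius factor of a finite radicial extension of a normal domain.** Let
`φ : A → C` be an injective finite homomorphism of domains, `C` of characteristic `p`, `A`
integrally closed, such that every `c ∈ C` satisfies `φ(s) · c^{p^n} = φ(a)` for some `n` and
`a, s ∈ A` with `s ≠ 0` (i.e. `Frac C / Frac A` is purely inseparable). Then for some `N` there
is a ring homomorphism `σ : C → A` with `φ (σ c) = c^{p^N}` and `σ (φ a) = a^{p^N}`: the `N`-th
Frobenius power of `C` factors through `A`. [folklore] -/
theorem exists_frobeniusFactor {A C : Type*} [CommRing A] [IsDomain A] [CommRing C]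
    [IsDomain C] [IsIntegrallyClosed A] (φ : A →+* C) (hφ : Function.Injective φ)
    (hfin : φ.Finite) (p : ℕ) [Fact p.Prime] [CharP C p]
    (hrad : ∀ c : C, ∃ (n : ℕ) (a s : A), s ≠ 0 ∧ φ s * c ^ p ^ n = φ a) :
    ∃ (N : ℕ) (σ : C →+* A), (∀ c, φ (σ c) = c ^ p ^ N) ∧ ∀ a, σ (φ a) = a ^ p ^ N := by
  letI : Algebra A C := φ.toAlgebra
  haveI : Module.Finite A C := hfin
  have hint : φ.IsIntegral := RingHom.IsIntegral.of_finite hfin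
  -- Step 1: pointwise exponents
  have key : ∀ c : C, ∃ (n : ℕ) (b : A), φ b = c ^ p ^ n := by
    intro c
    obtain ⟨n, a, s, hs, h⟩ := hrad c
    obtain ⟨b, hb⟩ := exists_eq_of_mul_eq_of_isIntegral φ hφ (c ^ p ^ n) (hint _) hs h
    exact ⟨n, b, hb⟩
  -- Step 2: a uniform exponent on a finite generating set, then everywhere by additivity
  obtain ⟨S, hS⟩ := Module.finite_def.mp ‹Module.Finite A C›
  choose n b hb using key
  let N : ℕ := S.sup n
  have hgen : ∀ c ∈ S, ∃ b' : A, φ b' = c ^ p ^ N := by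
    intro c hc
    refine ⟨b c ^ p ^ (N - n c), ?_⟩
    have hle : n c ≤ N := Finset.le_sup hc
    rw [map_pow, hb, ← pow_mul, ← pow_add, Nat.add_sub_cancel' hle]
  have hall : ∀ c : C, ∃ b' : A, φ b' = c ^ p ^ N := by
    intro c
    have hc : c ∈ Submodule.span A (S : Set C) := by rw [hS]; exact Submodule.mem_top
    induction hc using Submodule.span_induction with
    | mem x hx => exact hgen x hx
    | zero => exact ⟨0, by rw [map_zero, zero_pow (pow_ne_zero N (Fact.out : p.Prime).ne_zero)]⟩
    | add x y _ _ hx hy =>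
      obtain ⟨bx, hbx⟩ := hx
      obtain ⟨by', hby⟩ := hy
      exact ⟨bx + by', by rw [map_add, hbx, hby, add_pow_char_pow x y p N]⟩
    | smul a x _ hx =>
      obtain ⟨bx, hbx⟩ := hx
      refine ⟨a ^ p ^ N * bx, ?_⟩
      rw [map_mul, map_pow, hbx, Algebra.smul_def, mul_pow]
      rfl
  -- Step 3: the homomorphism
  choose s hs using hall
  have hs1 : s 1 = 1 := hφ (by rw [hs, one_pow, map_one])
  have hsmul : ∀ x y, s (x * y) = s x * s y := fun x y =>
    hφ (by rw [hs, map_mul, hs, hs, mul_pow])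
  have hs0 : s 0 = 0 := hφ (by
    rw [hs, map_zero, zero_pow (pow_ne_zero N (Fact.out : p.Prime).ne_zero)])
  have hsadd : ∀ x y, s (x + y) = s x + s y := fun x y =>
    hφ (by rw [hs, map_add, hs, hs, add_pow_char_pow x y p N])
  let σ : C →+* A :=
    { toFun := s, map_one' := hs1, map_mul' := hsmul, map_zero' := hs0, map_add' := hsadd }
  refine ⟨N, σ, fun c => hs c, fun a => hφ ?_⟩
  show φ (s (φ a)) = φ (a ^ p ^ N)
  rw [hs, map_pow]

end Summit.ResolutionOfSingularities.ResolutionOfSingularities.Theorems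

end
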